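import Summits.CriticalPhenomena.PercolationContinuityZ3.Theorems.PercNearOneGluingNoHeavyLowerTailCubicThreePointRegimeShadow
import Mathlib.Tactic.Ring
import Mathlib.Tactic.Linarith
import Mathlib.Tactic.Positivity
import HarnessLib

/-!
# `NoHeavyLowerTail` (stmt-CriticalPhenomena-4575) — the shadow row `S₅ = t·Γ₂ + q·Γ₁ − e₃` is CLOSED under the terminal operations
# (terminal–terminal chords `ab`, `ac`, `bc` of any weight; hanging a terminal on a pendant edge): explicit Bernstein pieces

Support file (prover prim-ineq-gen-2 gen 10; `--supports stmt-CriticalPhenomena-4575`).  Pure algebra, no measure theory, no named facts, no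
sorries.  Vocabulary: `CubicThreePointApex.{Shad, Gam1, Gam2, SBHK, HarS, HarT}` (`…RegimeShadow`, `…ApexDecoupled`), `CubicThreePointTerminal.Hqt`;
apex `a`, cells `(q,u₁,u₂,u₃,t)`, refinements `n = P(abc ∧ b≁c in ω∖a)`, `n′ = P(a|b|c ∧ V(C_a) separates b,c)`; `Γ₂ = AG − u₃n`, `Γ₁ = AG − u₃n′`
(theorems, `≥ 0`), `S = u₁u₂ − qn ≥ 0` (BHK 2006 Thm 1.4), `H = (t−n)q − u₃(u₁+u₂+n) ≥ 0` and `H′ = (q−n′)t − u₃(u₁+u₂+n′) ≥ 0` (Harris covariances),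
`S₅ = Shad`, `S₅ᵃ := Shad … n 0 = H_{q+t} − u₃tn ≥ S₅`, `S₅ᵇ := Shad … 0 n′ = H_{q+t} − u₃qn′ ≥ S₅`.

## The four operations (memo run/shared/lean/prim/prim-ineq-gen-2/SHADOW-S5.md §5)
Along ONE edge `e` of weight `p` the refined law is affine, `x(p) = (1−p)x⁰ + p x¹`, so the cubic `S₅(x(p))` has a Bernstein expansion
`(1−p)³B₀ + (1−p)²p·B₁ + (1−p)p²·B₂ + p³B₃` (`Bᵢ = 3bᵢ` for `i = 1,2`).  For the four TERMINAL operations the sections `x⁰, x¹` are explicit in the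
refined cells of the smaller graph (paper step, elementary: with `e = bc` open, `b ~ c` off `a` always and `q = u₁ = u₂ = n = 0`; with `e = ab` open,
`W, N′ → U₁`, `U₂ → N`, `U₃ → M`; a pendant apex `a′` hung on `a` has `n(a′) = 0` and, when its edge is closed, `W,N′,U₁,U₂ → W`, `U₃,N,M → U₃`; a pendant
terminal `b′` hung on `b`, edge closed: `W,U₃ → W`, `N′,U₁ → N′`, `U₂,N,M → U₂`; in all cases `n′` of the smaller graph is unchanged by the extra edge),
and the Bernstein pieces are (all identities by `ring`):
* chord `bc` (`H := G∖bc`, cells of `H`, `n′ ≡ 0` in `G`):  `B₀ = S₅ᵃ(H)`, `B₁ = S₅ᵃ(H) + (t+u₁+u₂)Γ₂(H) + t·S(H)`, `B₂ = (t+u₁+u₂)·H(H)`, `B₃ = 0`  (`chord_bc_bernstein`);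
* chord `ab` (`H := G∖ab`):  `B₀ = S₅(H)`, `B₁ = S₅ᵃ(H) + (t+u₂+u₃)Γ₂(H)`, `B₂ = (t+u₂+u₃)Γ₂(H)`, `B₃ = 0`  (`chord_ab_bernstein`; `ac` by `b ↔ c`, `chord_ac_bernstein`);
* pendant apex (`G` with apex `a`; new apex `a′` on `a`, weight `p`):  `B₀ = 0`, `B₁ = (q+u₁+u₂)H′`, `B₂ = S₅ᵇ + (u₁+u₂)Γ₁ + q·H′`, `B₃ = S₅ᵇ`  (`pendant_apex_bernstein`);
* pendant terminal (`b′` on `b`):  `B₀ = 0`, `B₁ = (q+u₁+u₃)Γ₁`, `B₂ = S₅ᵇ + (q+u₁+u₃)Γ₁`, `B₃ = S₅`  (`pendant_b_bernstein`; `c′` on `c`: `pendant_c_bernstein`).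
Every piece is a sum of products of nonnegative quantities once `S₅ ≥ 0` holds for the smaller graph (note `S₅ᵃ, S₅ᵇ ≥ S₅`, `Shad_drop_le`).  Hence
(`*_nonneg`): **the class `{S₅ ≥ 0}` is closed under terminal chords and terminal pendants**, exactly as prim-ineq-gen-1 FINDING-12 §2 found (by LP
certificates) for the fibre positivity of `H_{q+t}`; a minimal counterexample to `S₅ ≥ 0` has no terminal–terminal edge and all terminal degrees `≥ 2`.
Since `S₅ ≥ 0 ⟹ H_{q+t} ≥ 0` (`Hqt_nonneg_of_Shad`), the same closure transports `H_{q+t}` along.  STATUS of `S₅ ≥ 0` itself: conjectured (implied by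
the regime pair; three-copy comb positive on every support with `≤ 5` vertices; censuses in SHADOW-S5.md).
-/

namespace Summit.CriticalPhenomena.PercolationContinuityZ3.Theorems

namespace CubicThreePointApex

open CubicThreePointTerminal CubicThreePointSharp

variable {R : Type*} [CommRing R]

/-! ### Bernstein identities (any commutative ring) -/

/-- Chord `bc` of weight `p` added to `H` (cells of `H`; in `G = H + bc` the cell `n′` vanishes): Bernstein expansion of `S₅(G)`. [this work] -/
theorem chord_bc_bernstein (q u₁ u₂ u₃ t n p : R) :
    Shad ((1 - p) * q) ((1 - p) * u₁) ((1 - p) * u₂) (u₃ + p * q) (t + p * (u₁ + u₂)) ((1 - p) * n) 0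
      = (1 - p) ^ 3 * Shad q u₁ u₂ u₃ t n 0
        + (1 - p) ^ 2 * p * (Shad q u₁ u₂ u₃ t n 0 + (t + u₁ + u₂) * Gam2 q u₁ u₂ u₃ t n + t * SBHK q u₁ u₂ n)
        + (1 - p) * p ^ 2 * ((t + u₁ + u₂) * HarS q u₁ u₂ u₃ t n) := by
  simp only [Shad, Gam2, Gam1, SBHK, HarS, AG]; ring

/-- Chord `ab` of weight `p` added to `H` (refined cells of `H`): Bernstein expansion of `S₅(G)`. [this work] -/
theorem chord_ab_bernstein (q u₁ u₂ u₃ t n n' p : R) :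
    Shad ((1 - p) * q) (u₁ + p * q) ((1 - p) * u₂) ((1 - p) * u₃) (t + p * (u₂ + u₃)) (n + p * u₂) ((1 - p) * n')
      = (1 - p) ^ 3 * Shad q u₁ u₂ u₃ t n n'
        + (1 - p) ^ 2 * p * (Shad q u₁ u₂ u₃ t n 0 + (t + u₂ + u₃) * Gam2 q u₁ u₂ u₃ t n)
        + (1 - p) * p ^ 2 * ((t + u₂ + u₃) * Gam2 q u₁ u₂ u₃ t n) := by
  simp only [Shad, Gam2, Gam1, AG]; ring

/-- Chord `ac` of weight `p` (the `b ↔ c` mirror of `chord_ab_bernstein`). [this work] -/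
theorem chord_ac_bernstein (q u₁ u₂ u₃ t n n' p : R) :
    Shad ((1 - p) * q) ((1 - p) * u₁) (u₂ + p * q) ((1 - p) * u₃) (t + p * (u₁ + u₃)) (n + p * u₁) ((1 - p) * n')
      = (1 - p) ^ 3 * Shad q u₁ u₂ u₃ t n n'
        + (1 - p) ^ 2 * p * (Shad q u₁ u₂ u₃ t n 0 + (t + u₁ + u₃) * Gam2 q u₁ u₂ u₃ t n)
        + (1 - p) * p ^ 2 * ((t + u₁ + u₃) * Gam2 q u₁ u₂ u₃ t n) := by
  simp only [Shad, Gam2, Gam1, AG]; ring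

/-- Pendant apex: new apex `a′` hung on `a` by an edge of weight `p` (refined cells of `G` with apex `a`; split `q = W + n′`, `t = n + M`):
the law of `(a′; b, c)` is `p·(W, n′, u₁, u₂, u₃, 0, n+M) + (1−p)·(W+n′+u₁+u₂, 0, 0, 0, u₃+t, 0, 0)`. Bernstein expansion of its `S₅`. [this work] -/
theorem pendant_apex_bernstein (W n' u₁ u₂ u₃ n M p : R) :
    Shad (p * W + (1 - p) * (W + n' + u₁ + u₂) + p * n') (p * u₁) (p * u₂) (p * u₃ + (1 - p) * (u₃ + n + M)) (p * (n + M)) 0 (p * n')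
      = (1 - p) ^ 2 * p * ((W + n' + u₁ + u₂) * HarT (W + n') u₁ u₂ u₃ (n + M) n')
        + (1 - p) * p ^ 2 * (Shad (W + n') u₁ u₂ u₃ (n + M) 0 n' + (u₁ + u₂) * Gam1 (W + n') u₁ u₂ u₃ (n + M) n'
            + (W + n') * HarT (W + n') u₁ u₂ u₃ (n + M) n')
        + p ^ 3 * Shad (W + n') u₁ u₂ u₃ (n + M) 0 n' := by
  simp only [Shad, Gam2, Gam1, HarT, AG]; ring

/-- Pendant terminal: new terminal `b′` hung on `b` by an edge of weight `p` (refined cells of `G`): the law of `(a; b′, c)` is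
`p·x(G) + (1−p)·(W+u₃, n′+u₁, 0, u₂+t, 0, 0, 0)`. Bernstein expansion of its `S₅`. [this work] -/
theorem pendant_b_bernstein (W n' u₁ u₂ u₃ n M p : R) :
    Shad (p * W + (1 - p) * (W + u₃) + (p * n' + (1 - p) * (n' + u₁))) (p * u₁) (p * u₂ + (1 - p) * (u₂ + n + M)) (p * u₃)
        (p * n + p * M) (p * n) (p * n' + (1 - p) * (n' + u₁))
      = (1 - p) ^ 2 * p * ((W + n' + u₁ + u₃) * Gam1 (W + n') u₁ u₂ u₃ (n + M) n')
        + (1 - p) * p ^ 2 * (Shad (W + n') u₁ u₂ u₃ (n + M) 0 n' + (W + n' + u₁ + u₃) * Gam1 (W + n') u₁ u₂ u₃ (n + M) n')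
        + p ^ 3 * Shad (W + n') u₁ u₂ u₃ (n + M) n n' := by
  simp only [Shad, Gam2, Gam1, AG]; ring

/-- Pendant terminal at `c` (mirror of `pendant_b_bernstein`): closed branch `(W+u₃, n′+u₂, u₁+t, 0, 0, 0, 0)`. [this work] -/
theorem pendant_c_bernstein (W n' u₁ u₂ u₃ n M p : R) :
    Shad (p * W + (1 - p) * (W + u₃) + (p * n' + (1 - p) * (n' + u₂))) (p * u₁ + (1 - p) * (u₁ + n + M)) (p * u₂) (p * u₃)
        (p * n + p * M) (p * n) (p * n' + (1 - p) * (n' + u₂))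
      = (1 - p) ^ 2 * p * ((W + n' + u₂ + u₃) * Gam1 (W + n') u₁ u₂ u₃ (n + M) n')
        + (1 - p) * p ^ 2 * (Shad (W + n') u₁ u₂ u₃ (n + M) 0 n' + (W + n' + u₂ + u₃) * Gam1 (W + n') u₁ u₂ u₃ (n + M) n')
        + p ^ 3 * Shad (W + n') u₁ u₂ u₃ (n + M) n n' := by
  simp only [Shad, Gam2, Gam1, AG]; ring

/-! ### Closure (real cells): every piece is nonnegative once `S₅ ≥ 0` holds for the smaller graph -/

/-- `S₅ ≤ S₅ᵃ := S₅(…, n, 0)` and `S₅ ≤ S₅ᵇ := S₅(…, 0, n′)` for nonnegative `q, t, u₃, n, n′`. [this work] -/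
theorem Shad_drop_le (q u₁ u₂ u₃ t n n' : ℝ) (hq : 0 ≤ q) (ht : 0 ≤ t) (hu₃ : 0 ≤ u₃) (hn : 0 ≤ n) (hn' : 0 ≤ n') :
    Shad q u₁ u₂ u₃ t n n' ≤ Shad q u₁ u₂ u₃ t n 0 ∧ Shad q u₁ u₂ u₃ t n n' ≤ Shad q u₁ u₂ u₃ t 0 n' := by
  simp only [Shad_eq_Hqt_sub]
  constructor <;> nlinarith [mul_nonneg hu₃ (mul_nonneg hq hn'), mul_nonneg hu₃ (mul_nonneg ht hn)]

/-- A cubic Bernstein combination with nonnegative pieces is nonnegative on `[0,1]`. [folklore] -/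
theorem bernstein3_nonneg {p B₀ B₁ B₂ B₃ : ℝ} (hp0 : 0 ≤ p) (hp1 : p ≤ 1) (h0 : 0 ≤ B₀) (h1 : 0 ≤ B₁) (h2 : 0 ≤ B₂)
    (h3 : 0 ≤ B₃) : 0 ≤ (1 - p) ^ 3 * B₀ + (1 - p) ^ 2 * p * B₁ + (1 - p) * p ^ 2 * B₂ + p ^ 3 * B₃ := by
  have hq : 0 ≤ 1 - p := sub_nonneg.mpr hp1
  positivity

/-- **Chord `bc` closure.**  If `S₅ᵃ(H) ≥ 0` (in particular if `S₅(H) ≥ 0` with nonnegative cells), `Γ₂(H) ≥ 0`, `S(H) ≥ 0` (BHK) and `H(H) ≥ 0` (Harris),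
then `S₅(H + bc) ≥ 0` for every weight `p ∈ [0,1]` on `bc`. [this work] -/
theorem chord_bc_nonneg {q u₁ u₂ u₃ t n p : ℝ} (hp0 : 0 ≤ p) (hp1 : p ≤ 1) (hu₁ : 0 ≤ u₁) (hu₂ : 0 ≤ u₂) (ht : 0 ≤ t)
    (hS5 : 0 ≤ Shad q u₁ u₂ u₃ t n 0) (hG2 : 0 ≤ Gam2 q u₁ u₂ u₃ t n) (hS : 0 ≤ SBHK q u₁ u₂ n) (hH : 0 ≤ HarS q u₁ u₂ u₃ t n) :
    0 ≤ Shad ((1 - p) * q) ((1 - p) * u₁) ((1 - p) * u₂) (u₃ + p * q) (t + p * (u₁ + u₂)) ((1 - p) * n) 0 := by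
  rw [chord_bc_bernstein]
  have hB1 : 0 ≤ Shad q u₁ u₂ u₃ t n 0 + (t + u₁ + u₂) * Gam2 q u₁ u₂ u₃ t n + t * SBHK q u₁ u₂ n := by positivity
  have hB2 : 0 ≤ (t + u₁ + u₂) * HarS q u₁ u₂ u₃ t n := by positivity
  have h3 : 0 ≤ (1 - p) ^ 3 * Shad q u₁ u₂ u₃ t n 0
      + (1 - p) ^ 2 * p * (Shad q u₁ u₂ u₃ t n 0 + (t + u₁ + u₂) * Gam2 q u₁ u₂ u₃ t n + t * SBHK q u₁ u₂ n)
      + (1 - p) * p ^ 2 * ((t + u₁ + u₂) * HarS q u₁ u₂ u₃ t n) + p ^ 3 * 0 :=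
    bernstein3_nonneg hp0 hp1 hS5 hB1 hB2 (le_refl 0)
  linarith

/-- **Chord `ab` closure.**  If `S₅(H) ≥ 0`, `Γ₂(H) ≥ 0` and the cells are nonnegative, then `S₅(H + ab) ≥ 0` for every weight on `ab`. [this work] -/
theorem chord_ab_nonneg {q u₁ u₂ u₃ t n n' p : ℝ} (hp0 : 0 ≤ p) (hp1 : p ≤ 1) (hq : 0 ≤ q) (hu₂ : 0 ≤ u₂) (hu₃ : 0 ≤ u₃) (ht : 0 ≤ t)
    (hn : 0 ≤ n) (hn' : 0 ≤ n') (hS5 : 0 ≤ Shad q u₁ u₂ u₃ t n n') (hG2 : 0 ≤ Gam2 q u₁ u₂ u₃ t n) :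
    0 ≤ Shad ((1 - p) * q) (u₁ + p * q) ((1 - p) * u₂) ((1 - p) * u₃) (t + p * (u₂ + u₃)) (n + p * u₂) ((1 - p) * n') := by
  rw [chord_ab_bernstein]
  have hS5a : 0 ≤ Shad q u₁ u₂ u₃ t n 0 := le_trans hS5 (Shad_drop_le q u₁ u₂ u₃ t n n' hq ht hu₃ hn hn').1
  have hB1 : 0 ≤ Shad q u₁ u₂ u₃ t n 0 + (t + u₂ + u₃) * Gam2 q u₁ u₂ u₃ t n := by positivity
  have hB2 : 0 ≤ (t + u₂ + u₃) * Gam2 q u₁ u₂ u₃ t n := by positivity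
  have h3 : 0 ≤ (1 - p) ^ 3 * Shad q u₁ u₂ u₃ t n n'
      + (1 - p) ^ 2 * p * (Shad q u₁ u₂ u₃ t n 0 + (t + u₂ + u₃) * Gam2 q u₁ u₂ u₃ t n)
      + (1 - p) * p ^ 2 * ((t + u₂ + u₃) * Gam2 q u₁ u₂ u₃ t n) + p ^ 3 * 0 :=
    bernstein3_nonneg hp0 hp1 hS5 hB1 hB2 (le_refl 0)
  linarith

/-- **Chord `ac` closure** (mirror). [this work] -/
theorem chord_ac_nonneg {q u₁ u₂ u₃ t n n' p : ℝ} (hp0 : 0 ≤ p) (hp1 : p ≤ 1) (hq : 0 ≤ q) (hu₁ : 0 ≤ u₁) (hu₃ : 0 ≤ u₃) (ht : 0 ≤ t)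
    (hn : 0 ≤ n) (hn' : 0 ≤ n') (hS5 : 0 ≤ Shad q u₁ u₂ u₃ t n n') (hG2 : 0 ≤ Gam2 q u₁ u₂ u₃ t n) :
    0 ≤ Shad ((1 - p) * q) ((1 - p) * u₁) (u₂ + p * q) ((1 - p) * u₃) (t + p * (u₁ + u₃)) (n + p * u₁) ((1 - p) * n') := by
  rw [chord_ac_bernstein]
  have hS5a : 0 ≤ Shad q u₁ u₂ u₃ t n 0 := le_trans hS5 (Shad_drop_le q u₁ u₂ u₃ t n n' hq ht hu₃ hn hn').1
  have hB1 : 0 ≤ Shad q u₁ u₂ u₃ t n 0 + (t + u₁ + u₃) * Gam2 q u₁ u₂ u₃ t n := by positivity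
  have hB2 : 0 ≤ (t + u₁ + u₃) * Gam2 q u₁ u₂ u₃ t n := by positivity
  have h3 : 0 ≤ (1 - p) ^ 3 * Shad q u₁ u₂ u₃ t n n'
      + (1 - p) ^ 2 * p * (Shad q u₁ u₂ u₃ t n 0 + (t + u₁ + u₃) * Gam2 q u₁ u₂ u₃ t n)
      + (1 - p) * p ^ 2 * ((t + u₁ + u₃) * Gam2 q u₁ u₂ u₃ t n) + p ^ 3 * 0 :=
    bernstein3_nonneg hp0 hp1 hS5 hB1 hB2 (le_refl 0)
  linarith

/-- **Pendant-apex closure.**  If `S₅(G) ≥ 0` (apex `a`), `Γ₁(G) ≥ 0`, `H′(G) ≥ 0` (Harris) and the cells are nonnegative, then `S₅ ≥ 0` for the graph with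
a new apex `a′` hung on `a` by an edge of any weight `p ∈ [0,1]`. [this work] -/
theorem pendant_apex_nonneg {W n' u₁ u₂ u₃ n M p : ℝ} (hp0 : 0 ≤ p) (hp1 : p ≤ 1) (hW : 0 ≤ W) (hn' : 0 ≤ n') (hu₁ : 0 ≤ u₁)
    (hu₂ : 0 ≤ u₂) (hu₃ : 0 ≤ u₃) (hn : 0 ≤ n) (hM : 0 ≤ M) (hS5 : 0 ≤ Shad (W + n') u₁ u₂ u₃ (n + M) n n')
    (hG1 : 0 ≤ Gam1 (W + n') u₁ u₂ u₃ (n + M) n') (hH' : 0 ≤ HarT (W + n') u₁ u₂ u₃ (n + M) n') :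
    0 ≤ Shad (p * W + (1 - p) * (W + n' + u₁ + u₂) + p * n') (p * u₁) (p * u₂) (p * u₃ + (1 - p) * (u₃ + n + M))
        (p * (n + M)) 0 (p * n') := by
  rw [pendant_apex_bernstein]
  have hS5b : 0 ≤ Shad (W + n') u₁ u₂ u₃ (n + M) 0 n' :=
    le_trans hS5 (Shad_drop_le (W + n') u₁ u₂ u₃ (n + M) n n' (by positivity) (by positivity) hu₃ hn hn').2
  have hB1 : 0 ≤ (W + n' + u₁ + u₂) * HarT (W + n') u₁ u₂ u₃ (n + M) n' := by positivity
  have hB2 : 0 ≤ Shad (W + n') u₁ u₂ u₃ (n + M) 0 n' + (u₁ + u₂) * Gam1 (W + n') u₁ u₂ u₃ (n + M) n'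
      + (W + n') * HarT (W + n') u₁ u₂ u₃ (n + M) n' := by positivity
  have h3 : 0 ≤ (1 - p) ^ 3 * 0 + (1 - p) ^ 2 * p * ((W + n' + u₁ + u₂) * HarT (W + n') u₁ u₂ u₃ (n + M) n')
      + (1 - p) * p ^ 2 * (Shad (W + n') u₁ u₂ u₃ (n + M) 0 n' + (u₁ + u₂) * Gam1 (W + n') u₁ u₂ u₃ (n + M) n'
            + (W + n') * HarT (W + n') u₁ u₂ u₃ (n + M) n')
      + p ^ 3 * Shad (W + n') u₁ u₂ u₃ (n + M) 0 n' :=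
    bernstein3_nonneg hp0 hp1 (le_refl 0) hB1 hB2 hS5b
  linarith

/-- **Pendant-terminal closure (at `b`).**  If `S₅(G) ≥ 0`, `Γ₁(G) ≥ 0` and the cells are nonnegative, then `S₅ ≥ 0` for the graph with a new terminal
`b′` hung on `b` by an edge of any weight. [this work] -/
theorem pendant_b_nonneg {W n' u₁ u₂ u₃ n M p : ℝ} (hp0 : 0 ≤ p) (hp1 : p ≤ 1) (hW : 0 ≤ W) (hn' : 0 ≤ n') (hu₁ : 0 ≤ u₁)
    (hu₃ : 0 ≤ u₃) (hn : 0 ≤ n) (hM : 0 ≤ M) (hS5 : 0 ≤ Shad (W + n') u₁ u₂ u₃ (n + M) n n')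
    (hG1 : 0 ≤ Gam1 (W + n') u₁ u₂ u₃ (n + M) n') :
    0 ≤ Shad (p * W + (1 - p) * (W + u₃) + (p * n' + (1 - p) * (n' + u₁))) (p * u₁) (p * u₂ + (1 - p) * (u₂ + n + M)) (p * u₃)
        (p * n + p * M) (p * n) (p * n' + (1 - p) * (n' + u₁)) := by
  rw [pendant_b_bernstein]
  have hS5b : 0 ≤ Shad (W + n') u₁ u₂ u₃ (n + M) 0 n' :=
    le_trans hS5 (Shad_drop_le (W + n') u₁ u₂ u₃ (n + M) n n' (by positivity) (by positivity) hu₃ hn hn').2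
  have hB1 : 0 ≤ (W + n' + u₁ + u₃) * Gam1 (W + n') u₁ u₂ u₃ (n + M) n' := by positivity
  have hB2 : 0 ≤ Shad (W + n') u₁ u₂ u₃ (n + M) 0 n' + (W + n' + u₁ + u₃) * Gam1 (W + n') u₁ u₂ u₃ (n + M) n' := by
    positivity
  have h3 : 0 ≤ (1 - p) ^ 3 * 0 + (1 - p) ^ 2 * p * ((W + n' + u₁ + u₃) * Gam1 (W + n') u₁ u₂ u₃ (n + M) n')
      + (1 - p) * p ^ 2 * (Shad (W + n') u₁ u₂ u₃ (n + M) 0 n' + (W + n' + u₁ + u₃) * Gam1 (W + n') u₁ u₂ u₃ (n + M) n')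
      + p ^ 3 * Shad (W + n') u₁ u₂ u₃ (n + M) n n' :=
    bernstein3_nonneg hp0 hp1 (le_refl 0) hB1 hB2 hS5
  linarith

/-- **Pendant-terminal closure (at `c`).** [this work] -/
theorem pendant_c_nonneg {W n' u₁ u₂ u₃ n M p : ℝ} (hp0 : 0 ≤ p) (hp1 : p ≤ 1) (hW : 0 ≤ W) (hn' : 0 ≤ n') (hu₂ : 0 ≤ u₂)
    (hu₃ : 0 ≤ u₃) (hn : 0 ≤ n) (hM : 0 ≤ M) (hS5 : 0 ≤ Shad (W + n') u₁ u₂ u₃ (n + M) n n')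
    (hG1 : 0 ≤ Gam1 (W + n') u₁ u₂ u₃ (n + M) n') :
    0 ≤ Shad (p * W + (1 - p) * (W + u₃) + (p * n' + (1 - p) * (n' + u₂))) (p * u₁ + (1 - p) * (u₁ + n + M)) (p * u₂) (p * u₃)
        (p * n + p * M) (p * n) (p * n' + (1 - p) * (n' + u₂)) := by
  rw [pendant_c_bernstein]
  have hS5b : 0 ≤ Shad (W + n') u₁ u₂ u₃ (n + M) 0 n' :=
    le_trans hS5 (Shad_drop_le (W + n') u₁ u₂ u₃ (n + M) n n' (by positivity) (by positivity) hu₃ hn hn').2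
  have hB1 : 0 ≤ (W + n' + u₂ + u₃) * Gam1 (W + n') u₁ u₂ u₃ (n + M) n' := by positivity
  have hB2 : 0 ≤ Shad (W + n') u₁ u₂ u₃ (n + M) 0 n' + (W + n' + u₂ + u₃) * Gam1 (W + n') u₁ u₂ u₃ (n + M) n' := by
    positivity
  have h3 : 0 ≤ (1 - p) ^ 3 * 0 + (1 - p) ^ 2 * p * ((W + n' + u₂ + u₃) * Gam1 (W + n') u₁ u₂ u₃ (n + M) n')
      + (1 - p) * p ^ 2 * (Shad (W + n') u₁ u₂ u₃ (n + M) 0 n' + (W + n' + u₂ + u₃) * Gam1 (W + n') u₁ u₂ u₃ (n + M) n')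
      + p ^ 3 * Shad (W + n') u₁ u₂ u₃ (n + M) n n' :=
    bernstein3_nonneg hp0 hp1 (le_refl 0) hB1 hB2 hS5
  linarith

end CubicThreePointApex

end Summit.CriticalPhenomena.PercolationContinuityZ3.Theorems
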